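import Summits.HubbardSuperconductivity.HubbardSuperconductivity.Theses.BalabanIR
import Literature.Probability.LatticeModels.BalabanStepOneFormat
import Summits.HubbardSuperconductivity.HubbardSuperconductivity.Theorems.BalabanIRBirGappedPhaseReductionRFormatSplit
import HarnessLib

/-!
# Line `format_pair` — skeleton for crux `BalabanIR.BirGroundStateAverageLRO` (item stmt-HubbardSuperconductivity-2079)

Crux-strategist s3 (gen 1, 2026-08-17), ALTERNATIVE line (`--alt`; the registered line `Sketch` =
softmin-pair-penalty is untouched and stays dead: its only stub ⟹ the summit, p137379).

THE POINT. The format pair designed by the 4R strategist (stmt-14846, `Cruxes/BirGappedPhaseReductionR/SPLIT-PROPOSAL.md`)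
over the LANDED Defs layer `Literature.Probability.LatticeModels.BalabanStepOne` (p148658) closes THIS crux directly:
the landed structural glue `Theorems.birGappedPhaseReductionR_of_formatPair_target` (p160973,
`Theorems/BalabanIRBirGappedPhaseReductionRFormatSplit.lean`, Theses-free) has type
`body(C1) → body(C2) → body(BirGroundStateAverageLRO)`.  Since `BirGappedPhaseReductionR := 2R → 3 → X_avg` is X_avg
weakened by two inert hypotheses (p96034, p89422/p89798/p89620), X_avg — not 4R — is the natural parent of the pair, and a
skeleton concluding `BirGroundStateAverageLRO` BY NAME is what 36 lead seats on this item asked for (PICKED.md c20–c31 (a)).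

* `stub_formatEngine` = C1 `BirFormatEngine` (= 14845′): Balaban's engine RESTATED over weights in depth-one step-one format —
  Hubbard-free, crux-sized (open mathematics: multiscale expansion for COMPLEX quasi-local actions with continuous symmetry).
* `stub_formatMembershipTransfer` = C2 `BirFormatMembershipTransfer` (= 14846′): MEMBERSHIP ∧ TRANSFER about `hubbardTorus`
  alone — the two-regime constructive fermionic expansion below the BCS scale plus ensemble delivery, crux-sized
  (`Literature.Barriers.HubbardSuperconductivity.WeakCouplingCeiling` is the bet).

Both stubs are VERBATIM the stubs of 14846's registered line `format-pair` (lead c18/c19): one statement, one proof, two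
consumers.  DIVISION OF LABOUR (line card `Lines/format_pair.md`): supports for C1 (format calibration, real/OS faces) are
14846's lead's; the lead of THIS crux takes the C2 side (membership facts about the cyclic Trotter weight of the slaved block
pair field: FermionWeight / TimeRP / FockCoercivity / BlockLondon / SlavedTrotter families, and the canonical delivery
SectorFourier / TorusZeroMode*), landing them `--supports stmt-HubbardSuperconductivity-2079`.
Neither stub implies the crux or the summit on its own (C1 has no Hubbard content; C2's inner implication needs the engine
conclusion of its witness).  Recorded smell (strategist s3, `StrategistS3Sketch.lean`): `¬C1 → C2` (a format member violating
the engine conclusion makes C2's inner implication vacuous), so the children are JOINTLY load-bearing: `C1 ∧ C2` is the content.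
-/

set_option linter.dupNamespace false -- crux workfile namespace `Summit.<S>.<S>.Cruxes…` (D-0017 layout)

noncomputable section

namespace Summit.HubbardSuperconductivity.HubbardSuperconductivity.Cruxes.BirGroundStateAverageLRO.FormatPair

open scoped BigOperators ComplexConjugate
open MeasureTheory Filter Literature.Probability.LatticeModels Literature.MathematicalPhysics.QuantumLattice
open Summit.HubbardSuperconductivity.HubbardSuperconductivity.Theses.BalabanIR
open Summit.HubbardSuperconductivity.HubbardSuperconductivity.Theorems

/-! ## Registered stubs (verbatim C1, C2 of the format pair) -/

/-- **stub C1 (XL) — `BirFormatEngine`.** For every budget `B`, coercivity rate `c₀ > 0` and large-field rate `cL > 0` there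
are thresholds `κ₀, K₀, L₀` such that every weight in `StepOneFormat K B c₀ cL κ` with `κ ≥ κ₀`, `K ≥ K₀`, on an even block
torus `L₀ ≤ L' ≤ M`, has `Z ≠ 0` and slice order `≥ 1/2` (`EngineConclusion`).  Balaban1995–1998 (real actions, d = 3),
BFKT2017 (complex actions, no symmetry breaking): the complex, continuous-symmetry case from depth-one format is open. -/
theorem stub_formatEngine :
    ∀ (B c₀ cL : ℝ), 0 < c₀ → 0 < cL → ∃ κ₀ K₀ : ℝ, ∃ L₀ : ℕ, ∀ (κ K : ℝ), κ₀ ≤ κ → K₀ ≤ K → ∀ (L' M : ℕ) [NeZero L'] [NeZero M], L₀ ≤ L' → L' ≤ M → Even L' → Even M → ∀ ρ : (Literature.Probability.LatticeModels.TorusSite 2 L' × ZMod M → ℝ) → ℂ, Literature.Probability.LatticeModels.BalabanStepOne.StepOneFormat K B c₀ cL κ L' M ρ → Literature.Probability.LatticeModels.BalabanStepOne.EngineConclusion L' M ρ := by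
  sorry

/-- **stub C2 (XL) — `BirFormatMembershipTransfer`.** For some `δ ∈ (0,1/2)` and class data `(B, c₀, cL)`, every triple of
engine thresholds `(κ₀, K₀, L₀)` admits a weak-coupling window and `cP > 0` such that for every `U` in the window, eventually in
even `L`, frequently in `β`, some step-one-format weight at `κ ≥ κ₀`, `K ≥ K₀` on an even block torus `L₀ ≤ L' ≤ M` (intended: the
cyclic Trotter weight of the slaved block pair field of `hubbardTorus 2 L 1 U`) has the property that ITS engine conclusion implies
the canonical `(N_L, S^z = 0)`-sector thermal bound `cP·L⁴ ≤ Re tr(P_S e^{-βH} Δ_d†Δ_d)/tr(P_S e^{-βH})`.  The two-regime constructive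
expansion of the 2D Hubbard model below the BCS scale (WeakCouplingCeiling): open. -/
theorem stub_formatMembershipTransfer :
    ∃ δ ∈ Set.Ioo (0:ℝ) (1/2), ∃ (B c₀ cL : ℝ), 0 < c₀ ∧ 0 < cL ∧ ∀ (κ₀ K₀ : ℝ) (L₀ : ℕ), ∃ U₁ U₂ cP : ℝ, 0 < U₁ ∧ U₁ < U₂ ∧ 0 < cP ∧ ∀ U ∈ Set.Ioo U₁ U₂, ∃ L₁ : ℕ, ∀ (L : ℕ) [NeZero L], L₁ ≤ L → Even L → let N : ℕ := 2 * ⌊(1 - δ) * (L : ℝ) ^ 2 / 2⌋₊; let H := Literature.MathematicalPhysics.QuantumLattice.hubbardTorus 2 L 1 U; let S := Literature.MathematicalPhysics.QuantumLattice.szSector (Λ := Literature.MathematicalPhysics.QuantumLattice.FermionTorus 2 L) N 0; let PS := Literature.MathematicalPhysics.QuantumLattice.projMatrix (S.map (Literature.MathematicalPhysics.QuantumLattice.Fock.toEuclidean (ι := Literature.MathematicalPhysics.QuantumLattice.Orb (Literature.MathematicalPhysics.QuantumLattice.FermionTorus 2 L)) : Literature.MathematicalPhysics.QuantumLattice.Fock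 (Literature.MathematicalPhysics.QuantumLattice.Orb (Literature.MathematicalPhysics.QuantumLattice.FermionTorus 2 L)) →ₗ[ℂ] EuclideanSpace ℂ (Finset (Literature.MathematicalPhysics.QuantumLattice.Orb (Literature.MathematicalPhysics.QuantumLattice.FermionTorus 2 L))))); ∃ᶠ β : ℝ in Filter.atTop, ∃ (κ K : ℝ), κ₀ ≤ κ ∧ K₀ ≤ K ∧ ∃ (L' M : ℕ) (_ : NeZero L') (_ : NeZero M), L₀ ≤ L' ∧ L' ≤ M ∧ Even L' ∧ Even M ∧ ∃ ρ : (Literature.Probability.LatticeModels.TorusSite 2 L' × ZMod M → ℝ) → ℂ, Literature.Probability.LatticeModels.BalabanStepOne.StepOneFormat K B c₀ cL κ L' M ρ ∧ (Literature.Probability.LatticeModels.BalabanStepOne.EngineConclusion L' M ρ → cP * (L : ℝ) ^ 4 ≤ ((PS * Matrix.gibbsWeight β H * (Matrix.conjTranspose (Literature.MathematicalPhysics.QuantumLattice.pairField Literature.MathematicalPhysics.QuantumLattice.dWaveFormFactor L) * Literature.MathematicalPhysics.QuantumLattice.pairField Literature.MathematicalPhysics.QuantumLattice.dWaveFormFactor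 L)).trace / (PS * Matrix.gibbsWeight β H).trace).re) := by
  sorry

/-! ## Composition -/

/-- **The line closes the crux BY NAME modulo its two registered stubs**: the landed structural glue
`Theorems.birGappedPhaseReductionR_of_formatPair_target` (p160973) applied to the stubs after unfolding the route def
(its conclusion is the body of `BirGroundStateAverageLRO` verbatim; the `β → ∞` endgame inside it is the landed Theses-free
bridge `dWaveGroundStateAverageLRO_of_frequently_thermal`). -/
theorem BirGroundStateAverageLRO_of : BirGroundStateAverageLRO := by
  unfold BirGroundStateAverageLRO
  exact birGappedPhaseReductionR_of_formatPair_target stub_formatEngine stub_formatMembershipTransfer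

end Summit.HubbardSuperconductivity.HubbardSuperconductivity.Cruxes.BirGroundStateAverageLRO.FormatPair

end
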